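import Summits.QuantumFields.YangMills.Theorems.FluctuationComparisonRegPrIntLS2BetaResidualGaugeOrbit
import Literature.MathematicalPhysics.QuantumFieldTheory.Balaban1983to89.B11GaugeGlue
import Literature.MathematicalPhysics.QuantumFieldTheory.Balaban1983to89.B15PrelimIntegrations
import Mathlib.Algebra.Order.BigOperators.Ring.Finset
import HarnessLib

/-!
# (RG-K) Orbit-distance comparison by equivariance — «full-orbit distance ≍ residual-orbit distance on a fibre»

Definition-free helper for crux `stmt-QuantumFields-20520` (`Theses.UnitScaleTilt.FluctuationComparisonRegPrIntL`), the (T)-chain of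
LINE `semiclassical_s2beta` (cell `ym3-torus`, px21 g18 (T4) §1 `posCollar_of_growthOn_nhds` ∕ px8 g18 ✓`tubeGrowth_of_pos_of_isolated`).
The intrinsic growth letters of that chain are written with the RESIDUAL orbit functional
`D(A;B) := ⨅_{w residual} Σ_ℓ dist1 (A ℓ·((w•B) ℓ)⁻¹)²` (residual = descent-preserving, the v6 body of `ResidualGauge F hJK`), while
[Balaban1985RegularSpaces] Thm 2's Landau representation `W′ = (v⁻¹u)•(W·e^{iX})` exports a growth row against `d(W′, u•W)` for a fine
gauge transformation `u` that is (1.29)-restricted but NOT residual.  This file supplies the kinematic bridge, with every analytic input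
displayed as a hypothesis AT THE DATA:

* §1 (any `GaugeGroup G`, any torus) the `ℓ²`-rows of `d(A,B) := (Σ_ℓ dist1 (A ℓ·(B ℓ)⁻¹)²)^{1/2}`: symmetry, invariance under a common
  gauge transformation (`dist1` is conjugation-invariant), the Minkowski triangle inequality (Cauchy–Schwarz for finite sums; the
  bond-wise triangle is lit ✓`B15.PrelimIntegrations.dist1_fluct_le`).
* §2 (the `d = 3` family, residual set of `D_{J,K}`) the ORBIT TRIANGLE inequalities for the tree's `⨅`-functional VERBATIM:
  `D(A;C)^{1/2} ≤ d(A,B) + D(B;C)^{1/2}` and `D(A;C)^{1/2} ≤ D(A;B)^{1/2} + D(B;C)^{1/2}` (the infimum is attained on the compact residual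
  set ✓`exists_orbitDistSq_eq_iInf`; residual transformations compose ✓`residual_mul`, ✓`gaugeAct_mul_eq`).
* §3 ★ `iInf_orbitDistSq_le_of_chain` ∕ ★★ `iInf_orbitDistSq_le_of_equivariant_of_lipschitz`: for ANY comparison configuration `X`
  (print: `X := u•U₀`, [Balaban1985RegularSpaces] Thm 2) and ANY second base point `U₁` (print: the minimiser at the moved datum `u↓•V = D_{J,K}(u•U₀)`,
  ✓`T3PrintedRegularOrbits.descendTo_gaugeAct`), IF (E) `D(X;U₁) ≤ 0` («`u` carries the minimising residual orbit at `V` INTO the one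
  at `u↓•V`» — covariance + uniqueness of the minimising orbit at `u↓•V`), (Ls) `D(U₁;U₀) ≤ Ks²·s` (the minimising orbit is Lipschitz
  in the datum, `s` = the squared datum distance — [Balaban1985Variational] Thm 1, analyticity half) and (Lπ) `s ≤ Kπ²·d(X,W′)²`
  (Lipschitz descent between `X` and `W′`, which share NO datum — [Balaban1985Averaging] Prop. 5), THEN
  `D(W′;U₀) ≤ (1 + Ks·Kπ)²·d(W′,X)²`; ★★ `exists_residual_growth_of_growth` = the same in the `∃ w residual, (c∕(1+KsKπ)²)·Σ dist1² ≤ a`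
  shape of the (T6) dock's `hgrowth` binder.  No stabiliser argument and no `V`-dependent transversality constant enter: a non-residual `u`
  is absorbed by MOVING THE BASE POINT to the minimiser of the moved datum, paying only the Lipschitz modulus of `V ↦ [U₀(V)]`.

HONEST: metric bookkeeping (triangle inequalities); (E), (Ls), (Lπ) are hypotheses, NOT proved here; this file proves NO stub of the
line — POS∘ at the regular minimiser, ISOL∘(δ), TUBE-REG∘, GAP♯∘, S2β and crux 20520 stay OPEN; rung R3 (YM₃ on T³) is NOT d = 4, NOT
infinite volume, NOT a mass gap, NOT Clay; the Yang–Mills mass gap is NOT proved.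
-/

set_option autoImplicit false

noncomputable section

open Set
open Literature.MathematicalPhysics.QuantumFieldTheory.Balaban1983to89
open Literature.MathematicalPhysics.QuantumFieldTheory.Balaban1983to89.T3ContinuumYM3Torus
open Literature.MathematicalPhysics.QuantumFieldTheory.Balaban1983to89.T3UnitLawDensityEML
open Literature.MathematicalPhysics.QuantumFieldTheory.Balaban1983to89.T3UnitScaleTilt
open Literature.MathematicalPhysics.QuantumFieldTheory.Balaban1983to89.T3TiltDescent
open Literature.MathematicalPhysics.QuantumFieldTheory.Balaban1983to89.B11GaugeGlue (dist1_mul_inv_comm)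
open Literature.MathematicalPhysics.QuantumFieldTheory.Balaban1983to89.B15.PrelimIntegrations (dist1_fluct_le)
open Summit.QuantumFields.YangMills.Theorems.FluctuationComparisonRegPrIntLS2BetaResidualGauge
open Summit.QuantumFields.YangMills.Theorems.FluctuationComparisonRegPrIntLS2BetaResidualGaugeOrbit (exists_orbitDistSq_eq_iInf)

namespace Summit.QuantumFields.YangMills.Theorems.FluctuationComparisonRegPrIntLS2BetaOrbitDistComparison

/-! ## §1 The `ℓ²`-rows of `d(A,B) = (Σ_ℓ dist1 (A ℓ·(B ℓ)⁻¹)²)^{1/2}` (any gauge group, any torus) -/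

section L2

variable {ι : Type*} [Fintype ι]

/-- **MINKOWSKI FOR FINITE SUMS OF SQUARES** (from Cauchy–Schwarz): if `0 ≤ h ≤ f + g` termwise then
`(Σ h²)^{1/2} ≤ (Σ f²)^{1/2} + (Σ g²)^{1/2}`. [folklore] -/
theorem sqrt_sum_sq_le_of_le_add (f g h : ι → ℝ) (hh0 : ∀ i, 0 ≤ h i) (hh : ∀ i, h i ≤ f i + g i) :
    Real.sqrt (∑ i, h i ^ 2) ≤ Real.sqrt (∑ i, f i ^ 2) + Real.sqrt (∑ i, g i ^ 2) := by
  set A := Real.sqrt (∑ i, f i ^ 2) with hA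
  set B := Real.sqrt (∑ i, g i ^ 2) with hB
  have hA0 : 0 ≤ A := Real.sqrt_nonneg _
  have hB0 : 0 ≤ B := Real.sqrt_nonneg _
  have hAsq : A ^ 2 = ∑ i, f i ^ 2 := Real.sq_sqrt (Finset.sum_nonneg fun i _ => sq_nonneg _)
  have hBsq : B ^ 2 = ∑ i, g i ^ 2 := Real.sq_sqrt (Finset.sum_nonneg fun i _ => sq_nonneg _)
  have hcs : (∑ i, f i * g i) ^ 2 ≤ (A * B) ^ 2 := by
    rw [mul_pow, hAsq, hBsq]; exact Finset.sum_mul_sq_le_sq_mul_sq _ _ _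
  have hfg : ∑ i, f i * g i ≤ A * B := by
    have h1 := Real.le_sqrt_of_sq_le hcs
    rwa [Real.sqrt_sq (mul_nonneg hA0 hB0)] at h1
  have hsum : ∑ i, h i ^ 2 ≤ (A + B) ^ 2 := by
    calc ∑ i, h i ^ 2 ≤ ∑ i, (f i + g i) ^ 2 :=
          Finset.sum_le_sum fun i _ => pow_le_pow_left₀ (hh0 i) (hh i) 2
      _ = ∑ i, f i ^ 2 + 2 * ∑ i, f i * g i + ∑ i, g i ^ 2 := by
          simp only [add_sq, Finset.sum_add_distrib, Finset.mul_sum, mul_assoc]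
      _ ≤ A ^ 2 + 2 * (A * B) + B ^ 2 := by rw [hAsq, hBsq]; linarith
      _ = (A + B) ^ 2 := by ring
  exact Real.sqrt_le_iff.mpr ⟨add_nonneg hA0 hB0, hsum⟩

variable {P : Params} {j : ℕ} {G : Type*} [GaugeGroup G]

/-- **A COMMON GAUGE TRANSFORMATION DOES NOT CHANGE BOND-WISE QUOTIENT DISTANCES**:
`dist1 ((w•A) ℓ·((w•B) ℓ)⁻¹) = dist1 (A ℓ·(B ℓ)⁻¹)` — the quotient is the conjugate `w(ℓ.src)·(A ℓ·(B ℓ)⁻¹)·w(ℓ.src)⁻¹`.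
[cite: Balaban1985Averaging, (8) p.19] -/
theorem dist1_gaugeAct_mul_inv (w : Site P j → G) (A B : GaugeField P j G) (ℓ : PBond P j) :
    dist1 ((GaugeField.gaugeAct w A) ℓ * ((GaugeField.gaugeAct w B) ℓ)⁻¹) = dist1 (A ℓ * (B ℓ)⁻¹) := by
  have h : (GaugeField.gaugeAct w A) ℓ * ((GaugeField.gaugeAct w B) ℓ)⁻¹ = w ℓ.src * (A ℓ * (B ℓ)⁻¹) * (w ℓ.src)⁻¹ := by
    show w ℓ.src * A ℓ * (w ℓ.tgt)⁻¹ * (w ℓ.src * B ℓ * (w ℓ.tgt)⁻¹)⁻¹ = _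
    group
  rw [h, GaugeGroup.dist1_conj]

/-- The squared `ℓ²`-distance is invariant under a common gauge transformation. [cite: Balaban1985Averaging, (8) p.19] -/
theorem sum_dist1_sq_gaugeAct (w : Site P j → G) (A B : GaugeField P j G) :
    ∑ ℓ : PBond P j, dist1 ((GaugeField.gaugeAct w A) ℓ * ((GaugeField.gaugeAct w B) ℓ)⁻¹) ^ 2 =
      ∑ ℓ : PBond P j, dist1 (A ℓ * (B ℓ)⁻¹) ^ 2 :=
  Finset.sum_congr rfl fun ℓ _ => by rw [dist1_gaugeAct_mul_inv]

/-- The squared `ℓ²`-distance is symmetric. [folklore] -/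
theorem sum_dist1_sq_comm (A B : GaugeField P j G) :
    ∑ ℓ : PBond P j, dist1 (A ℓ * (B ℓ)⁻¹) ^ 2 = ∑ ℓ : PBond P j, dist1 (B ℓ * (A ℓ)⁻¹) ^ 2 :=
  Finset.sum_congr rfl fun ℓ _ => by rw [dist1_mul_inv_comm]

/-- **THE `ℓ²` TRIANGLE INEQUALITY** `d(A,C) ≤ d(A,B) + d(B,C)` for `d(A,B) = (Σ_ℓ dist1 (A ℓ·(B ℓ)⁻¹)²)^{1/2}`. [folklore] -/
theorem sqrt_sum_dist1_sq_triangle (A B C : GaugeField P j G) :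
    Real.sqrt (∑ ℓ : PBond P j, dist1 (A ℓ * (C ℓ)⁻¹) ^ 2) ≤
      Real.sqrt (∑ ℓ : PBond P j, dist1 (A ℓ * (B ℓ)⁻¹) ^ 2) + Real.sqrt (∑ ℓ : PBond P j, dist1 (B ℓ * (C ℓ)⁻¹) ^ 2) :=
  sqrt_sum_sq_le_of_le_add (fun ℓ => dist1 (A ℓ * (B ℓ)⁻¹)) (fun ℓ => dist1 (B ℓ * (C ℓ)⁻¹)) (fun ℓ => dist1 (A ℓ * (C ℓ)⁻¹))
    (fun _ => GaugeGroup.dist1_nonneg _) fun ℓ => dist1_fluct_le (A ℓ) (B ℓ) (C ℓ)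

end L2

/-! ## §2 Orbit triangle inequalities for the residual orbit functional of `D_{J,K}` -/

section Orbit

variable (F : T3Family) {J K : ℕ} (hJK : J ≤ K)

/-- The orbit functional is bounded by its value at any residual transformation:
`D(A;C) ≤ Σ_ℓ dist1 (A ℓ·((w•C) ℓ)⁻¹)²`. [cite: Balaban1985Variational, (10) p.279] -/
theorem iInf_orbitDistSq_le_of_residual (A C : GaugeField (F.P K) 0 (Matrix.specialUnitaryGroup (Fin 2) ℂ))
    {w : Site (F.P K) 0 → Matrix.specialUnitaryGroup (Fin 2) ℂ}
    (hw : ∀ U : GaugeField (F.P K) 0 (Matrix.specialUnitaryGroup (Fin 2) ℂ),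
      descendTo F ℰp J K hJK (GaugeField.gaugeAct w U) = descendTo F ℰp J K hJK U) :
    (⨅ w' : {w : Site (F.P K) 0 → Matrix.specialUnitaryGroup (Fin 2) ℂ |
          ∀ U : GaugeField (F.P K) 0 (Matrix.specialUnitaryGroup (Fin 2) ℂ),
            descendTo F ℰp J K hJK (GaugeField.gaugeAct w U) = descendTo F ℰp J K hJK U},
        ∑ ℓ : PBond (F.P K) 0,
          dist1 (A ℓ * ((GaugeField.gaugeAct (w' : Site (F.P K) 0 → Matrix.specialUnitaryGroup (Fin 2) ℂ) C) ℓ)⁻¹) ^ 2) ≤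
      ∑ ℓ : PBond (F.P K) 0, dist1 (A ℓ * ((GaugeField.gaugeAct w C) ℓ)⁻¹) ^ 2 := by
  have hbdd : BddBelow (Set.range fun w' : {w : Site (F.P K) 0 → Matrix.specialUnitaryGroup (Fin 2) ℂ |
      ∀ U : GaugeField (F.P K) 0 (Matrix.specialUnitaryGroup (Fin 2) ℂ),
        descendTo F ℰp J K hJK (GaugeField.gaugeAct w U) = descendTo F ℰp J K hJK U} =>
      ∑ ℓ : PBond (F.P K) 0,
        dist1 (A ℓ * ((GaugeField.gaugeAct (w' : Site (F.P K) 0 → Matrix.specialUnitaryGroup (Fin 2) ℂ) C) ℓ)⁻¹) ^ 2) :=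
    ⟨0, by rintro _ ⟨w', rfl⟩; exact Finset.sum_nonneg fun ℓ _ => sq_nonneg _⟩
  exact ciInf_le hbdd ⟨w, hw⟩

/-- The orbit functional is non-negative. [cite: Balaban1985Variational, (10) p.279] -/
theorem iInf_orbitDistSq_nonneg (A C : GaugeField (F.P K) 0 (Matrix.specialUnitaryGroup (Fin 2) ℂ)) :
    0 ≤ ⨅ w' : {w : Site (F.P K) 0 → Matrix.specialUnitaryGroup (Fin 2) ℂ |
          ∀ U : GaugeField (F.P K) 0 (Matrix.specialUnitaryGroup (Fin 2) ℂ),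
            descendTo F ℰp J K hJK (GaugeField.gaugeAct w U) = descendTo F ℰp J K hJK U},
        ∑ ℓ : PBond (F.P K) 0,
          dist1 (A ℓ * ((GaugeField.gaugeAct (w' : Site (F.P K) 0 → Matrix.specialUnitaryGroup (Fin 2) ℂ) C) ℓ)⁻¹) ^ 2 := by
  haveI : Nonempty {w : Site (F.P K) 0 → Matrix.specialUnitaryGroup (Fin 2) ℂ |
      ∀ U : GaugeField (F.P K) 0 (Matrix.specialUnitaryGroup (Fin 2) ℂ),
        descendTo F ℰp J K hJK (GaugeField.gaugeAct w U) = descendTo F ℰp J K hJK U} := ⟨⟨1, residual_one F hJK⟩⟩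
  exact le_ciInf fun w' => Finset.sum_nonneg fun ℓ _ => sq_nonneg _

/-- ★ **MIXED ORBIT TRIANGLE**: `D(A;C)^{1/2} ≤ d(A,B) + D(B;C)^{1/2}` — take a residual `w₀` attaining `D(B;C)` and use the `ℓ²` triangle
through `w₀•C`. [cite: Balaban1985Variational, (10) p.279] -/
theorem sqrt_iInf_orbitDistSq_le_dist_add (A B C : GaugeField (F.P K) 0 (Matrix.specialUnitaryGroup (Fin 2) ℂ)) :
    Real.sqrt (⨅ w' : {w : Site (F.P K) 0 → Matrix.specialUnitaryGroup (Fin 2) ℂ |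
          ∀ U : GaugeField (F.P K) 0 (Matrix.specialUnitaryGroup (Fin 2) ℂ),
            descendTo F ℰp J K hJK (GaugeField.gaugeAct w U) = descendTo F ℰp J K hJK U},
        ∑ ℓ : PBond (F.P K) 0,
          dist1 (A ℓ * ((GaugeField.gaugeAct (w' : Site (F.P K) 0 → Matrix.specialUnitaryGroup (Fin 2) ℂ) C) ℓ)⁻¹) ^ 2) ≤
      Real.sqrt (∑ ℓ : PBond (F.P K) 0, dist1 (A ℓ * (B ℓ)⁻¹) ^ 2) +
        Real.sqrt (⨅ w' : {w : Site (F.P K) 0 → Matrix.specialUnitaryGroup (Fin 2) ℂ |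
            ∀ U : GaugeField (F.P K) 0 (Matrix.specialUnitaryGroup (Fin 2) ℂ),
              descendTo F ℰp J K hJK (GaugeField.gaugeAct w U) = descendTo F ℰp J K hJK U},
          ∑ ℓ : PBond (F.P K) 0,
            dist1 (B ℓ * ((GaugeField.gaugeAct (w' : Site (F.P K) 0 → Matrix.specialUnitaryGroup (Fin 2) ℂ) C) ℓ)⁻¹) ^ 2) := by
  obtain ⟨w₀, hw₀⟩ := exists_orbitDistSq_eq_iInf F hJK B C
  rw [← hw₀]
  calc Real.sqrt (⨅ w' : {w : Site (F.P K) 0 → Matrix.specialUnitaryGroup (Fin 2) ℂ |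
            ∀ U : GaugeField (F.P K) 0 (Matrix.specialUnitaryGroup (Fin 2) ℂ),
              descendTo F ℰp J K hJK (GaugeField.gaugeAct w U) = descendTo F ℰp J K hJK U},
          ∑ ℓ : PBond (F.P K) 0,
            dist1 (A ℓ * ((GaugeField.gaugeAct (w' : Site (F.P K) 0 → Matrix.specialUnitaryGroup (Fin 2) ℂ) C) ℓ)⁻¹) ^ 2)
      ≤ Real.sqrt (∑ ℓ : PBond (F.P K) 0, dist1 (A ℓ *
          ((GaugeField.gaugeAct (w₀ : Site (F.P K) 0 → Matrix.specialUnitaryGroup (Fin 2) ℂ) C) ℓ)⁻¹) ^ 2) :=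
        Real.sqrt_le_sqrt (iInf_orbitDistSq_le_of_residual F hJK A C w₀.2)
    _ ≤ _ := sqrt_sum_dist1_sq_triangle _ _ _

/-- ★ **ORBIT TRIANGLE**: `D(A;C)^{1/2} ≤ D(A;B)^{1/2} + D(B;C)^{1/2}` — with residual `w₁` attaining `D(A;B)` and `w₀` attaining `D(B;C)`,
the residual product `w₁w₀` (✓`residual_mul`) gives `d(A,(w₁w₀)•C) ≤ d(A,w₁•B) + d(w₁•B,w₁•(w₀•C)) = D(A;B)^{1/2} + d(B,w₀•C)`.
[cite: Balaban1985Variational, (10) p.279; Balaban1987RG1, p.256] -/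
theorem sqrt_iInf_orbitDistSq_triangle (A B C : GaugeField (F.P K) 0 (Matrix.specialUnitaryGroup (Fin 2) ℂ)) :
    Real.sqrt (⨅ w' : {w : Site (F.P K) 0 → Matrix.specialUnitaryGroup (Fin 2) ℂ |
          ∀ U : GaugeField (F.P K) 0 (Matrix.specialUnitaryGroup (Fin 2) ℂ),
            descendTo F ℰp J K hJK (GaugeField.gaugeAct w U) = descendTo F ℰp J K hJK U},
        ∑ ℓ : PBond (F.P K) 0,
          dist1 (A ℓ * ((GaugeField.gaugeAct (w' : Site (F.P K) 0 → Matrix.specialUnitaryGroup (Fin 2) ℂ) C) ℓ)⁻¹) ^ 2) ≤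
      Real.sqrt (⨅ w' : {w : Site (F.P K) 0 → Matrix.specialUnitaryGroup (Fin 2) ℂ |
            ∀ U : GaugeField (F.P K) 0 (Matrix.specialUnitaryGroup (Fin 2) ℂ),
              descendTo F ℰp J K hJK (GaugeField.gaugeAct w U) = descendTo F ℰp J K hJK U},
          ∑ ℓ : PBond (F.P K) 0,
            dist1 (A ℓ * ((GaugeField.gaugeAct (w' : Site (F.P K) 0 → Matrix.specialUnitaryGroup (Fin 2) ℂ) B) ℓ)⁻¹) ^ 2) +
        Real.sqrt (⨅ w' : {w : Site (F.P K) 0 → Matrix.specialUnitaryGroup (Fin 2) ℂ |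
            ∀ U : GaugeField (F.P K) 0 (Matrix.specialUnitaryGroup (Fin 2) ℂ),
              descendTo F ℰp J K hJK (GaugeField.gaugeAct w U) = descendTo F ℰp J K hJK U},
          ∑ ℓ : PBond (F.P K) 0,
            dist1 (B ℓ * ((GaugeField.gaugeAct (w' : Site (F.P K) 0 → Matrix.specialUnitaryGroup (Fin 2) ℂ) C) ℓ)⁻¹) ^ 2) := by
  obtain ⟨w₁, hw₁⟩ := exists_orbitDistSq_eq_iInf F hJK A B
  obtain ⟨w₀, hw₀⟩ := exists_orbitDistSq_eq_iInf F hJK B C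
  rw [← hw₁, ← hw₀]
  have hres := residual_mul F hJK w₁.2 w₀.2
  calc Real.sqrt (⨅ w' : {w : Site (F.P K) 0 → Matrix.specialUnitaryGroup (Fin 2) ℂ |
            ∀ U : GaugeField (F.P K) 0 (Matrix.specialUnitaryGroup (Fin 2) ℂ),
              descendTo F ℰp J K hJK (GaugeField.gaugeAct w U) = descendTo F ℰp J K hJK U},
          ∑ ℓ : PBond (F.P K) 0,
            dist1 (A ℓ * ((GaugeField.gaugeAct (w' : Site (F.P K) 0 → Matrix.specialUnitaryGroup (Fin 2) ℂ) C) ℓ)⁻¹) ^ 2)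
      ≤ Real.sqrt (∑ ℓ : PBond (F.P K) 0, dist1 (A ℓ *
          ((GaugeField.gaugeAct ((w₁ : Site (F.P K) 0 → Matrix.specialUnitaryGroup (Fin 2) ℂ) *
            (w₀ : Site (F.P K) 0 → Matrix.specialUnitaryGroup (Fin 2) ℂ)) C) ℓ)⁻¹) ^ 2) :=
        Real.sqrt_le_sqrt (iInf_orbitDistSq_le_of_residual F hJK A C hres)
    _ = Real.sqrt (∑ ℓ : PBond (F.P K) 0, dist1 (A ℓ *
          ((GaugeField.gaugeAct (w₁ : Site (F.P K) 0 → Matrix.specialUnitaryGroup (Fin 2) ℂ)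
            (GaugeField.gaugeAct (w₀ : Site (F.P K) 0 → Matrix.specialUnitaryGroup (Fin 2) ℂ) C)) ℓ)⁻¹) ^ 2) := by
        rw [gaugeAct_mul_eq]
    _ ≤ Real.sqrt (∑ ℓ : PBond (F.P K) 0, dist1 (A ℓ *
            ((GaugeField.gaugeAct (w₁ : Site (F.P K) 0 → Matrix.specialUnitaryGroup (Fin 2) ℂ) B) ℓ)⁻¹) ^ 2) +
          Real.sqrt (∑ ℓ : PBond (F.P K) 0,
            dist1 ((GaugeField.gaugeAct (w₁ : Site (F.P K) 0 → Matrix.specialUnitaryGroup (Fin 2) ℂ) B) ℓ *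
              ((GaugeField.gaugeAct (w₁ : Site (F.P K) 0 → Matrix.specialUnitaryGroup (Fin 2) ℂ)
                (GaugeField.gaugeAct (w₀ : Site (F.P K) 0 → Matrix.specialUnitaryGroup (Fin 2) ℂ) C)) ℓ)⁻¹) ^ 2) :=
        sqrt_sum_dist1_sq_triangle _ _ _
    _ = _ := by rw [sum_dist1_sq_gaugeAct]

end Orbit

/-! ## §3 The comparison: a non-residual `u` is absorbed by moving the base point -/

section Comparison

variable (F : T3Family) {J K : ℕ} (hJK : J ≤ K)

/-- ★ **THE CHAIN** (hypothesis-free): for any configurations `W′, X, U₀, U₁`,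
`D(W′;U₀)^{1/2} ≤ d(W′,X) + D(X;U₁)^{1/2} + D(U₁;U₀)^{1/2}` — the mixed orbit triangle `W′ → X → [U₀]` followed by the orbit triangle
`X → [U₁] → [U₀]`.  Print's reading: `X = u•U₀` (Thm 2's Landau representative, `u` NOT residual), `U₁` = the minimiser at the moved
datum `u↓•V`. [cite: Balaban1985Variational, Thm 1 (8)-(10) p.279; Balaban1985RegularSpaces, Thm 2 p.83] -/
theorem sqrt_iInf_orbitDistSq_le_of_chain (W' X U₀ U₁ : GaugeField (F.P K) 0 (Matrix.specialUnitaryGroup (Fin 2) ℂ)) :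
    Real.sqrt (⨅ w' : {w : Site (F.P K) 0 → Matrix.specialUnitaryGroup (Fin 2) ℂ |
          ∀ U : GaugeField (F.P K) 0 (Matrix.specialUnitaryGroup (Fin 2) ℂ),
            descendTo F ℰp J K hJK (GaugeField.gaugeAct w U) = descendTo F ℰp J K hJK U},
        ∑ ℓ : PBond (F.P K) 0,
          dist1 (W' ℓ * ((GaugeField.gaugeAct (w' : Site (F.P K) 0 → Matrix.specialUnitaryGroup (Fin 2) ℂ) U₀) ℓ)⁻¹) ^ 2) ≤
      Real.sqrt (∑ ℓ : PBond (F.P K) 0, dist1 (W' ℓ * (X ℓ)⁻¹) ^ 2) +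
        Real.sqrt (⨅ w' : {w : Site (F.P K) 0 → Matrix.specialUnitaryGroup (Fin 2) ℂ |
            ∀ U : GaugeField (F.P K) 0 (Matrix.specialUnitaryGroup (Fin 2) ℂ),
              descendTo F ℰp J K hJK (GaugeField.gaugeAct w U) = descendTo F ℰp J K hJK U},
          ∑ ℓ : PBond (F.P K) 0,
            dist1 (X ℓ * ((GaugeField.gaugeAct (w' : Site (F.P K) 0 → Matrix.specialUnitaryGroup (Fin 2) ℂ) U₁) ℓ)⁻¹) ^ 2) +
        Real.sqrt (⨅ w' : {w : Site (F.P K) 0 → Matrix.specialUnitaryGroup (Fin 2) ℂ |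
            ∀ U : GaugeField (F.P K) 0 (Matrix.specialUnitaryGroup (Fin 2) ℂ),
              descendTo F ℰp J K hJK (GaugeField.gaugeAct w U) = descendTo F ℰp J K hJK U},
          ∑ ℓ : PBond (F.P K) 0,
            dist1 (U₁ ℓ * ((GaugeField.gaugeAct (w' : Site (F.P K) 0 → Matrix.specialUnitaryGroup (Fin 2) ℂ) U₀) ℓ)⁻¹) ^ 2) := by
  have h1 := sqrt_iInf_orbitDistSq_le_dist_add F hJK W' X U₀
  have h2 := sqrt_iInf_orbitDistSq_triangle F hJK X U₁ U₀
  linarith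

/-- ★★ **ORBIT-DISTANCE COMPARISON BY EQUIVARIANCE — «full-orbit distance ≍ residual-orbit distance on a fibre»**.
For configurations `W′, X, U₀, U₁`, a real `s` and constants `Ks, Kπ ≥ 0`: IF
(E) `D(X;U₁) ≤ 0` (print: `X = u•U₀` lies ON the minimising residual orbit `[U₁]` of the moved datum `u↓•V` — covariance of the
action, of the UV-small-history events and of `D_{J,K}`, plus uniqueness of the minimising orbit there),
(Ls) `D(U₁;U₀) ≤ Ks²·s` (the minimising residual orbit is Lipschitz in the datum; `s` = the squared datum distance `Σ_b dist1 (V₁ b·(V b)⁻¹)²`),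
(Lπ) `s ≤ Kπ²·d(X,W′)²` (Lipschitz descent: `D_{J,K} X = V₁`, `D_{J,K} W′ = V`),
THEN `D(W′;U₀) ≤ (1 + Ks·Kπ)²·d(W′,X)²`.  Consequence for the (T)-chain: a growth row `c·d(W′,u•W)² ≤ A W′ − A W` exported against
a NON-residual `u` ([Balaban1985RegularSpaces] Thm 2, `u` (1.29)-restricted) yields the intrinsic row `(c∕(1+KsKπ)²)·D W′ ≤ A W′ − A W`
of (T4) §1 `posCollar_of_growthOn_nhds`, with no constant depending on the datum `V`.
[cite: Balaban1985Variational, Thm 1 (8)-(10) p.279; Balaban1985RegularSpaces, Thm 2 p.83, (1.29) p.81, (1.36) p.82; Balaban1985Averaging, Prop. 5 (157) p.42] -/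
theorem iInf_orbitDistSq_le_of_equivariant_of_lipschitz
    (W' X U₀ U₁ : GaugeField (F.P K) 0 (Matrix.specialUnitaryGroup (Fin 2) ℂ)) {s Ks Kπ : ℝ} (hKs : 0 ≤ Ks) (hKπ : 0 ≤ Kπ)
    (hE : (⨅ w' : {w : Site (F.P K) 0 → Matrix.specialUnitaryGroup (Fin 2) ℂ |
            ∀ U : GaugeField (F.P K) 0 (Matrix.specialUnitaryGroup (Fin 2) ℂ),
              descendTo F ℰp J K hJK (GaugeField.gaugeAct w U) = descendTo F ℰp J K hJK U},
          ∑ ℓ : PBond (F.P K) 0,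
            dist1 (X ℓ * ((GaugeField.gaugeAct (w' : Site (F.P K) 0 → Matrix.specialUnitaryGroup (Fin 2) ℂ) U₁) ℓ)⁻¹) ^ 2) ≤ 0)
    (hLs : (⨅ w' : {w : Site (F.P K) 0 → Matrix.specialUnitaryGroup (Fin 2) ℂ |
            ∀ U : GaugeField (F.P K) 0 (Matrix.specialUnitaryGroup (Fin 2) ℂ),
              descendTo F ℰp J K hJK (GaugeField.gaugeAct w U) = descendTo F ℰp J K hJK U},
          ∑ ℓ : PBond (F.P K) 0,
            dist1 (U₁ ℓ * ((GaugeField.gaugeAct (w' : Site (F.P K) 0 → Matrix.specialUnitaryGroup (Fin 2) ℂ) U₀) ℓ)⁻¹) ^ 2) ≤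
        Ks ^ 2 * s)
    (hLπ : s ≤ Kπ ^ 2 * ∑ ℓ : PBond (F.P K) 0, dist1 (X ℓ * (W' ℓ)⁻¹) ^ 2) :
    (⨅ w' : {w : Site (F.P K) 0 → Matrix.specialUnitaryGroup (Fin 2) ℂ |
          ∀ U : GaugeField (F.P K) 0 (Matrix.specialUnitaryGroup (Fin 2) ℂ),
            descendTo F ℰp J K hJK (GaugeField.gaugeAct w U) = descendTo F ℰp J K hJK U},
        ∑ ℓ : PBond (F.P K) 0,
          dist1 (W' ℓ * ((GaugeField.gaugeAct (w' : Site (F.P K) 0 → Matrix.specialUnitaryGroup (Fin 2) ℂ) U₀) ℓ)⁻¹) ^ 2) ≤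
      (1 + Ks * Kπ) ^ 2 * ∑ ℓ : PBond (F.P K) 0, dist1 (W' ℓ * (X ℓ)⁻¹) ^ 2 := by
  -- the chain, then abbreviate its four quantities
  have hchain := sqrt_iInf_orbitDistSq_le_of_chain F hJK W' X U₀ U₁
  have hX0 := iInf_orbitDistSq_nonneg F hJK X U₁
  have hW0 := iInf_orbitDistSq_nonneg F hJK W' U₀
  set DW := ⨅ w' : {w : Site (F.P K) 0 → Matrix.specialUnitaryGroup (Fin 2) ℂ |
          ∀ U : GaugeField (F.P K) 0 (Matrix.specialUnitaryGroup (Fin 2) ℂ),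
            descendTo F ℰp J K hJK (GaugeField.gaugeAct w U) = descendTo F ℰp J K hJK U},
        ∑ ℓ : PBond (F.P K) 0,
          dist1 (W' ℓ * ((GaugeField.gaugeAct (w' : Site (F.P K) 0 → Matrix.specialUnitaryGroup (Fin 2) ℂ) U₀) ℓ)⁻¹) ^ 2
    with hDW
  set DX := ⨅ w' : {w : Site (F.P K) 0 → Matrix.specialUnitaryGroup (Fin 2) ℂ |
          ∀ U : GaugeField (F.P K) 0 (Matrix.specialUnitaryGroup (Fin 2) ℂ),
            descendTo F ℰp J K hJK (GaugeField.gaugeAct w U) = descendTo F ℰp J K hJK U},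
        ∑ ℓ : PBond (F.P K) 0,
          dist1 (X ℓ * ((GaugeField.gaugeAct (w' : Site (F.P K) 0 → Matrix.specialUnitaryGroup (Fin 2) ℂ) U₁) ℓ)⁻¹) ^ 2
    with hDX
  set D1 := ⨅ w' : {w : Site (F.P K) 0 → Matrix.specialUnitaryGroup (Fin 2) ℂ |
          ∀ U : GaugeField (F.P K) 0 (Matrix.specialUnitaryGroup (Fin 2) ℂ),
            descendTo F ℰp J K hJK (GaugeField.gaugeAct w U) = descendTo F ℰp J K hJK U},
        ∑ ℓ : PBond (F.P K) 0,
          dist1 (U₁ ℓ * ((GaugeField.gaugeAct (w' : Site (F.P K) 0 → Matrix.specialUnitaryGroup (Fin 2) ℂ) U₀) ℓ)⁻¹) ^ 2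
    with hD1
  set e2 := ∑ ℓ : PBond (F.P K) 0, dist1 (W' ℓ * (X ℓ)⁻¹) ^ 2 with he2
  have he2' : ∑ ℓ : PBond (F.P K) 0, dist1 (X ℓ * (W' ℓ)⁻¹) ^ 2 = e2 := by rw [he2, sum_dist1_sq_comm]
  have he0 : 0 ≤ e2 := Finset.sum_nonneg fun ℓ _ => sq_nonneg _
  -- (E): `D(X;U₁) = 0`
  have hsqX : Real.sqrt DX = 0 := by rw [le_antisymm hE hX0, Real.sqrt_zero]
  -- (Ls) ∘ (Lπ): `D(U₁;U₀)^{1/2} ≤ Ks·Kπ·d(W′,X)`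
  have hsq1 : Real.sqrt D1 ≤ Ks * Kπ * Real.sqrt e2 := by
    have hb : D1 ≤ (Ks * Kπ * Real.sqrt e2) ^ 2 := by
      have h' : (Ks * Kπ * Real.sqrt e2) ^ 2 = Ks ^ 2 * (Kπ ^ 2 * e2) := by
        rw [mul_pow, mul_pow, Real.sq_sqrt he0]; ring
      rw [h']
      exact hLs.trans (mul_le_mul_of_nonneg_left (hLπ.trans (le_of_eq (by rw [he2']))) (sq_nonneg _))
    exact (Real.sqrt_le_sqrt hb).trans (le_of_eq (Real.sqrt_sq (by positivity)))
  have hsqW : Real.sqrt DW ≤ (1 + Ks * Kπ) * Real.sqrt e2 := by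
    rw [hsqX] at hchain; nlinarith [hchain, hsq1]
  calc DW = Real.sqrt DW ^ 2 := (Real.sq_sqrt hW0).symm
    _ ≤ ((1 + Ks * Kπ) * Real.sqrt e2) ^ 2 := pow_le_pow_left₀ (Real.sqrt_nonneg _) hsqW 2
    _ = (1 + Ks * Kπ) ^ 2 * e2 := by rw [mul_pow, Real.sq_sqrt he0]

/-- ★★ **THE SAME, IN THE `∃ residual` SHAPE OF THE (T6) DOCK** (`posCollar_of_orbitGrowth_residual`'s `hgrowth` binder): a growth row
`c·d(W′,u•U₀)² ≤ a` against ANY fine `u` (print: [Balaban1985RegularSpaces] Thm 2's (1.29)-restricted transformation, `a = A W′ − A U₀`)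
becomes, under (E) at `X := u•U₀`, (Ls) and (Lπ), the row `(c∕(1+Ks·Kπ)²)·Σ_ℓ dist1 (W′ ℓ·((w•U₀) ℓ)⁻¹)² ≤ a` for a RESIDUAL `w` — the one
attaining the orbit functional (✓`exists_orbitDistSq_eq_iInf`).
[cite: Balaban1985Variational, Thm 1 (8)-(10) p.279; Balaban1985RegularSpaces, Thm 2 p.83, (1.29) p.81; Balaban1985Averaging, Prop. 5 (157) p.42] -/
theorem exists_residual_growth_of_growth
    (W' U₀ U₁ : GaugeField (F.P K) 0 (Matrix.specialUnitaryGroup (Fin 2) ℂ)) (u : Site (F.P K) 0 → Matrix.specialUnitaryGroup (Fin 2) ℂ)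
    {s Ks Kπ c a : ℝ} (hKs : 0 ≤ Ks) (hKπ : 0 ≤ Kπ) (hc : 0 ≤ c)
    (hE : (⨅ w' : {w : Site (F.P K) 0 → Matrix.specialUnitaryGroup (Fin 2) ℂ |
            ∀ U : GaugeField (F.P K) 0 (Matrix.specialUnitaryGroup (Fin 2) ℂ),
              descendTo F ℰp J K hJK (GaugeField.gaugeAct w U) = descendTo F ℰp J K hJK U},
          ∑ ℓ : PBond (F.P K) 0,
            dist1 ((GaugeField.gaugeAct u U₀) ℓ *
              ((GaugeField.gaugeAct (w' : Site (F.P K) 0 → Matrix.specialUnitaryGroup (Fin 2) ℂ) U₁) ℓ)⁻¹) ^ 2) ≤ 0)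
    (hLs : (⨅ w' : {w : Site (F.P K) 0 → Matrix.specialUnitaryGroup (Fin 2) ℂ |
            ∀ U : GaugeField (F.P K) 0 (Matrix.specialUnitaryGroup (Fin 2) ℂ),
              descendTo F ℰp J K hJK (GaugeField.gaugeAct w U) = descendTo F ℰp J K hJK U},
          ∑ ℓ : PBond (F.P K) 0,
            dist1 (U₁ ℓ * ((GaugeField.gaugeAct (w' : Site (F.P K) 0 → Matrix.specialUnitaryGroup (Fin 2) ℂ) U₀) ℓ)⁻¹) ^ 2) ≤
        Ks ^ 2 * s)
    (hLπ : s ≤ Kπ ^ 2 * ∑ ℓ : PBond (F.P K) 0, dist1 ((GaugeField.gaugeAct u U₀) ℓ * (W' ℓ)⁻¹) ^ 2)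
    (hgrow : c * ∑ ℓ : PBond (F.P K) 0, dist1 (W' ℓ * ((GaugeField.gaugeAct u U₀) ℓ)⁻¹) ^ 2 ≤ a) :
    ∃ w : Site (F.P K) 0 → Matrix.specialUnitaryGroup (Fin 2) ℂ,
      (∀ U'' : GaugeField (F.P K) 0 (Matrix.specialUnitaryGroup (Fin 2) ℂ),
          descendTo F ℰp J K hJK (GaugeField.gaugeAct w U'') = descendTo F ℰp J K hJK U'') ∧
        c / (1 + Ks * Kπ) ^ 2 * ∑ ℓ : PBond (F.P K) 0, dist1 (W' ℓ * ((GaugeField.gaugeAct w U₀) ℓ)⁻¹) ^ 2 ≤ a := by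
  have hcmp := iInf_orbitDistSq_le_of_equivariant_of_lipschitz F hJK W' (GaugeField.gaugeAct u U₀) U₀ U₁ hKs hKπ hE hLs hLπ
  obtain ⟨w₀, hw₀⟩ := exists_orbitDistSq_eq_iInf F hJK W' U₀
  refine ⟨(w₀ : Site (F.P K) 0 → Matrix.specialUnitaryGroup (Fin 2) ℂ), w₀.2, ?_⟩
  rw [hw₀]
  have hM : 0 < (1 + Ks * Kπ) ^ 2 := by positivity
  calc c / (1 + Ks * Kπ) ^ 2 * (⨅ w' : {w : Site (F.P K) 0 → Matrix.specialUnitaryGroup (Fin 2) ℂ |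
            ∀ U : GaugeField (F.P K) 0 (Matrix.specialUnitaryGroup (Fin 2) ℂ),
              descendTo F ℰp J K hJK (GaugeField.gaugeAct w U) = descendTo F ℰp J K hJK U},
          ∑ ℓ : PBond (F.P K) 0,
            dist1 (W' ℓ * ((GaugeField.gaugeAct (w' : Site (F.P K) 0 → Matrix.specialUnitaryGroup (Fin 2) ℂ) U₀) ℓ)⁻¹) ^ 2)
      ≤ c / (1 + Ks * Kπ) ^ 2 * ((1 + Ks * Kπ) ^ 2 * ∑ ℓ : PBond (F.P K) 0,
          dist1 (W' ℓ * ((GaugeField.gaugeAct u U₀) ℓ)⁻¹) ^ 2) :=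
        mul_le_mul_of_nonneg_left hcmp (div_nonneg hc hM.le)
    _ = c * ∑ ℓ : PBond (F.P K) 0, dist1 (W' ℓ * ((GaugeField.gaugeAct u U₀) ℓ)⁻¹) ^ 2 := by
        field_simp
    _ ≤ a := hgrow

end Comparison

end Summit.QuantumFields.YangMills.Theorems.FluctuationComparisonRegPrIntLS2BetaOrbitDistComparison

end
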